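import Literature.MathematicalPhysics.QuantumFieldTheory.OSRegularisedGeometric
import Literature.MathematicalPhysics.QuantumFieldTheory.OSPointwiseAnalyticity
import HarnessLib

/-!
# The smeared density at real points is the sector extension of the skeleton (OS II, Ch. VI.1 (6.8))

Topic `Literature/MathematicalPhysics/QuantumFieldTheory`; support file (all proved; no definitions;
no named facts) for the mean-value step of Osterwalder–Schrader II, Ch. VI.1 toward the
temperedness estimate (4.5) with exponent linear in the number of points. A local density `S` of
`𝔖_{k+2}` near `x`, smeared against the cluster `⊗ⱼ φⱼ(· − Xⱼ)` of profiles centred at a nearby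
configuration `X`, gives the Schwinger function of the cluster; by translation invariance (E1) this
is the directional skeleton Schwinger function at the skeleton coordinates `U` of `X`
(`posAff U = X`), i.e. the real value of the sector extension `geomG` of `OSRegularisedGeometric`:

* `tsupport_skeletonFnV_tensorFin_subset` — the cluster is supported in `closedBall X r₀`;
* `schwinger_skeletonFnV_tensorFin_eq_geomG` — `𝔖_{k+2}(⊗φ(· − X)) = geomG b φ (eRealPt U)`;
* `integral_density_mul_tensorFin_eq_geomG` —
  `∫ S(cfgPt y) ∏ⱼ φⱼ(yⱼ − Xⱼ) dy = geomG b φ (eRealPt U)`.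

## References

* K. Osterwalder, R. Schrader, *Axioms for Euclidean Green's functions II*, Comm. Math. Phys. 42
  (1975) 281–305, Ch. V.1 (5.7), Ch. VI.1 (6.5), (6.8). [OsterwalderSchraderCMP1975]
-/

noncomputable section

open MeasureTheory Complex Set Metric Filter
open _root_.Topology
open scoped InnerProductSpace RealInnerProductSpace SchwartzMap NNReal Real

namespace Literature.MathematicalPhysics.QuantumFieldTheory

open Literature.MathematicalPhysics.QuantumLattice (SchwingerFamily IsPositiveTimeMulti schwartzNorm)
open Literature.MathematicalPhysics.QuantumLattice.SchwingerFamily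
open Literature.MathematicalPhysics.QuantumLattice.SchwingerFamily.OSSpace
open Literature.Analysis.FunctionSpaces.SchwartzAverage
open Literature.Analysis.Distribution
open Literature.Analysis.Complex
open OSFrames

variable {d : ℕ} [NeZero d]

omit [NeZero d] in
/-- **Support of a cluster of profiles of radius `r₀`**: in the closed (sup-norm) ball of radius `r₀`
about the centre configuration. [folklore] -/
theorem tsupport_skeletonFnV_tensorFin_subset {n : ℕ} (φ : Fin n → 𝓢(EuclideanSpace ℝ (Fin d), ℂ)) {r₀ : ℝ} (hr₀ : 0 ≤ r₀)
    (hφ : ∀ j, tsupport (φ j : EuclideanSpace ℝ (Fin d) → ℂ) ⊆ Metric.closedBall 0 r₀) (X : Fin n → EuclideanSpace ℝ (Fin d)) :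
    tsupport (skeletonFnV (SchwartzMap.tensorFin n φ) X : (Fin n → EuclideanSpace ℝ (Fin d)) → ℂ) ⊆ closedBall X r₀ := by
  refine closure_minimal (fun y hy => ?_) isClosed_closedBall
  rw [Function.mem_support, skeletonFnV_apply, SchwartzMap.tensorFin_apply] at hy
  rw [mem_closedBall, dist_eq_norm, pi_norm_le_iff_of_nonneg hr₀]
  intro j
  have hj : φ j (y j - X j) ≠ 0 := fun h => hy (Finset.prod_eq_zero (Finset.mem_univ j) h)
  have hmem := hφ j (subset_tsupport _ (Function.mem_support.2 hj))
  rwa [mem_closedBall, dist_zero_right] at hmem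

section RealIdentity

variable (𝔖 : SchwingerFamily (EuclideanSpace ℝ (Fin d))) (hE2 : 𝔖.IsOSReflectionPositive) {k : ℕ}
  (ξ : Fin (k + 1) → EuclideanSpace ℝ (Fin d)) (ê : Fin d → EuclideanSpace ℝ (Fin d)) (hli : LinearIndependent ℝ ê) {g r₀ : ℝ}
  {b : ℝ} (hb : 0 < b) (hE1 : 𝔖.IsEuclideanCovariant)
  (hê1 : ∀ μ, ‖ê μ‖ = 1) (hêê : ∀ μ ν, 0 ≤ ⟪ê μ, ê ν⟫) (hξ : ∀ μ i', g ≤ ⟪ê μ, ξ i'⟫)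
  (hg : 2 * r₀ < g) (hr₀ : 0 ≤ r₀)
  {s : ℕ} {Cv : ℕ → ℝ} (hCv : ∀ n, 0 ≤ Cv n)
  (hv : ∀ (n : ℕ) (K : 𝓢((Fin n → EuclideanSpace ℝ (Fin d)), ℂ)) (hK : IsPositiveTimeMulti K),
    ‖ι 𝔖 hE2 (δ 𝔖 hE2 (mkGen K hK))‖ ≤ Cv n * schwartzNorm ((n + n) * s) K)
  {M : ℕ} (hM : (k + 1 + (k + 1)) * s ≤ M)
  {s₀ : ℕ} {C₀ : ℝ} (hC₀ : 0 ≤ C₀)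
  (hσ : ∀ F : 𝓢((Fin (k + 2) → EuclideanSpace ℝ (Fin d)), ℂ), ‖𝔖 (k + 2) F‖ ≤ C₀ * schwartzNorm s₀ F)
  {a R B : ℝ} (hR : 1 ≤ R) (hB : 0 ≤ B) (ha : 0 ≤ a)

include hb hE1 hê1 hêê hξ hg hr₀ hCv hv hM hC₀ hσ hR hB ha

/-- **The Schwinger function of a cluster centred at `X = posAff U` is the real value of the sector
extension**: `𝔖_{k+2}(⊗φ(· − X)) = geomG b φ (eRealPt U)` (E1: the first point is translated away). [cite: OsterwalderSchraderCMP1975, Ch. V.1 (5.7), Ch. VI.1 (6.8)] -/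
theorem schwinger_skeletonFnV_tensorFin_eq_geomG (φ : Fin (k + 2) → 𝓢(EuclideanSpace ℝ (Fin d), ℂ))
    (hφ : ∀ j, tsupport (φ j : EuclideanSpace ℝ (Fin d) → ℂ) ⊆ Metric.closedBall 0 r₀)
    (hφg : ∀ j, ∀ k' ≤ M, ∀ i' ≤ M, SchwartzMap.seminorm ℝ k' i' (φ j) ≤ a * R ^ k' * B ^ i')
    (U : EuclideanSpace ℝ (Fin (k + 2) × Fin d)) (hpos : ∀ j, 0 < tailR U j) :
    𝔖 (k + 2) (skeletonFnV (SchwartzMap.tensorFin (k + 2) φ) (posAff ξ ê hli U)) = geomG 𝔖 ξ ê b φ (eRealPt U) := by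
  have h1 : posAff ξ ê hli U = fun j => posV ξ ê (tailBlocks U) j + dirMap ê hli (fun μ => U (0, μ)) :=
    funext fun j => posAff_eq_posV ξ ê hli U j
  rw [h1, ← schwinger_skeletonFnV_add_const hE1, geomG_eRealPt 𝔖 hE2 ξ ê hb hE1 hê1 hêê hξ hg hr₀ hCv hv hM hC₀ hσ hR hB ha φ hφ hφg U hpos,
    skelSVr, reindexV_tailR]
  rfl

/-- **The smeared density at a real point is the sector extension**: for a local density `S` of
`𝔖_{k+2}` on `ball x ρ` and a centre `X` with `‖X − x‖ + r₀ < ρ`,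
`∫ S(cfgPt y) ∏ⱼ φⱼ(yⱼ − Xⱼ) dy = geomG b φ (eRealPt U)`, `U = posLin⁻¹ (X − pbase)`. [cite: OsterwalderSchraderCMP1975, Ch. VI.1 (6.5), (6.8)] -/
theorem integral_density_mul_tensorFin_eq_geomG (φ : Fin (k + 2) → 𝓢(EuclideanSpace ℝ (Fin d), ℂ))
    (hφ : ∀ j, tsupport (φ j : EuclideanSpace ℝ (Fin d) → ℂ) ⊆ Metric.closedBall 0 r₀)
    (hφg : ∀ j, ∀ k' ≤ M, ∀ i' ≤ M, SchwartzMap.seminorm ℝ k' i' (φ j) ≤ a * R ^ k' * B ^ i')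
    {x : Fin (k + 2) → EuclideanSpace ℝ (Fin d)} {ρ : ℝ} {S : (Fin (k + 2) → Fin d → ℂ) → ℂ}
    (hSrep : ∀ F : 𝓢((Fin (k + 2) → EuclideanSpace ℝ (Fin d)), ℂ),
      tsupport (F : (Fin (k + 2) → EuclideanSpace ℝ (Fin d)) → ℂ) ⊆ Metric.ball x ρ → 𝔖 (k + 2) F = ∫ y, S (cfgPt y) * F y)
    (X : Fin (k + 2) → EuclideanSpace ℝ (Fin d)) (hX : ‖X - x‖ + r₀ < ρ)
    (hpos : ∀ j, 0 < tailR ((posLinCLE ê hli).symm (X - pbase ξ)) j) :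
    ∫ y, S (cfgPt y) * SchwartzMap.tensorFin (k + 2) φ (fun j => y j - X j) =
      geomG 𝔖 ξ ê b φ (eRealPt ((posLinCLE ê hli).symm (X - pbase ξ))) := by
  set U := (posLinCLE ê hli).symm (X - pbase ξ) with hU
  have hXU : posAff ξ ê hli U = X := by
    rw [posAff, hU, ContinuousLinearEquiv.apply_symm_apply, add_sub_cancel]
  -- the cluster is supported in the ball of the local representation
  have hsupp : tsupport (skeletonFnV (SchwartzMap.tensorFin (k + 2) φ) X : (Fin (k + 2) → EuclideanSpace ℝ (Fin d)) → ℂ) ⊆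
      Metric.ball x ρ := by
    refine (tsupport_skeletonFnV_tensorFin_subset φ hr₀ hφ X).trans fun y hy => ?_
    rw [mem_closedBall, dist_eq_norm] at hy
    rw [mem_ball, dist_eq_norm]
    calc ‖y - x‖ = ‖(y - X) + (X - x)‖ := by rw [sub_add_sub_cancel]
      _ ≤ ‖y - X‖ + ‖X - x‖ := norm_add_le _ _
      _ < ρ := by linarith
  have hrep := hSrep _ hsupp
  simp only [skeletonFnV_apply] at hrep
  rw [← hrep, ← hXU, schwinger_skeletonFnV_tensorFin_eq_geomG 𝔖 hE2 ξ ê hli hb hE1 hê1 hêê hξ hg hr₀ hCv hv hM hC₀ hσ hR hB ha φ hφ hφg U hpos]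

end RealIdentity

end Literature.MathematicalPhysics.QuantumFieldTheory
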